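import Summits.Ventures.GridStability.Lyapunov.RelativeLffClosedForm
import Summits.Ventures.GridStability.Models.NE39L
import HarnessLib

/-!
# GridStability/Lyapunov/NE39LLffRoa — LFF P2 instance: the SOLVER-FREE Vu–Turitsyn certificate of the
# 10-machine New England LOSSLESS VARIANT `NE39L` (closed form, `ν = 1/10`)

Cell `gridfusion` (LADDER-GRIDFUSION), LFF lane (lead 2026-08-27T01:47:59Z: «P2 object of record =
model-1's `NE39L`»; lit-6 register §9.14); seat gridfusion-lyap-1 (g3); namespace
`Summit.Ventures.GridStability.Lyapunov.NE39LLff`. LABEL OF EVERY MENTION: «synthetic VARIANT of the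
New England 39-bus reduction — transfer conductances dropped (MV-2L), injections REDISPATCHED to the
lossless flow (MV-RD), uniform damping `D_i = λM_i` (MV-λ), h12 pre-fault data (MV-h12) — a PIPELINE
sentence about MODEL M′, not a sentence about the printed New England system».

INPUTS. model-1's object `Models/NE39L.lean` (p486685: `NE39L.data : RecastData 9`, machine `0` the
reference, exact circle points, `data_Cc_pos`, `data_B_symm`, `data_eqData`, the hypothesis-free
bridge `NE39L.hasDerivWithinAt_lffState_off`); the generic closed form `Lyapunov/RelativeLffClosedForm.lean`
(`RelativeLff.cert`, `RelativeLff.well_subset_regionOfAttraction`,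
`RelativeLff.synchronisation_of_isSolutionOn`: Sherman–Morrison `N⁻¹`, weighted Cauchy–Schwarz PSD
criterion) over lit-6's `Certificate.relativeClosedForm` [cite: VuTuritsyn2016, §III eq. (QKH), §IV set ℛ].

WHAT IS CERTIFIED HERE (kernel, exact rational arithmetic, `decide`): `M_i > 0`; the PSD margin
`ν = 1/10 < min_m M′_m` with `Σ_m M′_m²/(M′_m − 1/10) ≤ S = M_0 + Σ_m M′_m` (`= 7827/1885`; the
criterion fails at `ν = 11/100`), hence `N⁻¹ − (1/10)·1 ⪰ 0`; every circle point is ACUTE (`s_i ≥ 0`,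
`c_i > 0`, so all `θ*_i = arccos c_i ∈ [0, π/2)`, spread `< 39°`) hence `|θ*_i − θ*_j| < π/2` on all 90
ordered pairs; all couplings `C_ij > 0`. CONSEQUENCES (the generic schema instantiated): for every
damping ratio `λ > 0` the closed-form member `cert lam hlam` (`c = 1`, `g = λ/2`, `c′ = 2/λ + λ/2`) is a
Vu–Turitsyn certificate of `NE39L.lffSystemOff lam`; for every level `c₀ < V(0) + c′·w_k·vtGap(θ*_k)`
the set `{x ∈ 𝒫 | V x ≤ c₀}` is positively invariant with every global solution from it tending to `0`
(`ne39lLff_well_subset_regionOfAttraction`); and read on the typed classical model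
(`synchronisation_of_isSolutionOn`): every solution of `NE39L.data.toModelRel lam a′` whose initial
relative state lies in that set has `(δ_m − δ_0) − (θ*_m − θ*_0) → 0`, `ω_m − ω_0 → 0` for all nine
machines `m` — synchronisation with the reference machine. Level SYMBOLIC (explicit rational level =
successor item: enclosures of `arccos c_i`, `π` via `Models/AngleEnclosure.lean`). NO SDP, no matrix
certificate, no solver anywhere in the chain.

THREE COLUMNS. CERTIFIED: the facts and two sentences above, for MODEL M′. MODELLED: M′ =
network-reduced classical 10-machine model, lossless variant with redispatched injections and uniform
damping (MV-2L + MV-RD + MV-λ + MV-h12), reference machine `0` (RULING 13).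
VALIDATED: nothing. No sentence of this file says that the New England system or any grid is stable.
One `def` (`cert`); no named fact; standard axioms.
-/

noncomputable section

open Set Filter Topology Real
open Literature.MathematicalPhysics.PowerSystems
open Literature.MathematicalPhysics.PowerSystems.LyapunovFunctionFamily
open Literature.MathematicalPhysics.PowerSystems.ClassicalModel.LosslessSystem (vtGap)
open Summit.Ventures.GridStability.Models
open Summit.Ventures.GridStability.Lyapunov.RelativeLff

namespace Summit.Ventures.GridStability.Lyapunov.NE39LLff

/-! ### Instance facts (exact rational arithmetic) -/

/-- All ten inertias are positive. -/
theorem M_pos : ∀ i : Fin 10, 0 < NE39L.data.M i := by decide +kernel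

/-- The PSD margin `ν = 1/10` lies below every non-reference inertia `M′_m = M_{m+1}`. -/
theorem nu_lt_Mμ : ∀ m : Fin 9, (1 / 10 : ℝ) < Mμ NE39L.data m := by
  have hq : ∀ m : Fin 9, (1 / 10 : ℚ) < NE39L.data.M m.succ := by decide +kernel
  intro m
  unfold Mμ
  rw [show (1 / 10 : ℝ) = ((1 / 10 : ℚ) : ℝ) by norm_num]
  exact Rat.cast_lt.2 (hq m)

/-- **The scalar PSD criterion at `ν = 1/10`**: `Σ_m M′_m²/(M′_m − 1/10) ≤ S = M_0 + Σ_m M′_m`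
(exact rationals; `≈ 4.048 ≤ 4.152`). -/
theorem cs_criterion :
    ∑ m, Mμ NE39L.data m ^ 2 / (Mμ NE39L.data m - 1 / 10) ≤ S NE39L.data := by
  have hq : ∑ m : Fin 9, NE39L.data.M m.succ ^ 2 / (NE39L.data.M m.succ - 1 / 10)
      ≤ NE39L.data.M 0 + ∑ m : Fin 9, NE39L.data.M m.succ := by decide +kernel
  have h := (Rat.cast_le (K := ℝ)).2 hq
  unfold S Mμ Mref
  push_cast at h
  exact h

/-- Every circle point of `NE39L` is acute: `s_i ≥ 0` and `c_i > 0`. -/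
theorem acute : (∀ i : Fin 10, 0 ≤ NE39L.data.s i) ∧ ∀ i : Fin 10, 0 < NE39L.data.c i := by
  constructor <;> decide +kernel

/-- Hence every equilibrium line angle lies inside the polytope: `|θ*_i − θ*_j| < π/2`. -/
theorem abs_δs_lt (k : RecastData.LffPair 9) :
    |RecastData.lffδso NE39L.data.angleOf k| < π / 2 :=
  abs_δs_lt_of_acute NE39L.data acute.1 acute.2 k

/-! ### The certificate member and the certified region -/

/-- **The closed-form Vu–Turitsyn certificate of `NE39L`, for every damping ratio `λ > 0`**
(`N⁻¹` = Sherman–Morrison, `ν = 1/10`, `c = 1`, `g = λ/2`, `c′ = 2/λ + λ/2`). Type inferred: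
`Certificate (System.relativeSwing (Mμ NE39L.data) …)` = `Certificate (NE39L.lffSystemOff lam)`
(`RelativeLff.lffSystemOff_eq`, definitional). MODELLED column object; [cite: VuTuritsyn2016, §III eq. (QKH)] -/
def cert (lam : ℚ) (hlam : 0 < lam) :=
  RelativeLff.cert NE39L.data lam hlam NE39L.data.angleOf (ν := 1 / 10) (by norm_num) M_pos nu_lt_Mμ
    cs_criterion NE39L.data_Cc_pos

/-- **P2: the certified synchronisation region of the New England lossless uniform-λ VARIANT `NE39L`,
from the closed-form certificate** ([cite: VuTuritsyn2016, §IV set ℛ]). For every `λ > 0`, every level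
`c₀ < V(0) + c′·w_k·vtGap(θ*_k)` on all 90 ordered machine pairs `k`, and every relative state `y` in
the polytope `𝒫` with `V y ≤ c₀`: a global solution of the relative LFF field
(`= (NE39L.lffSystemOff lam).field`) exists, and EVERY global solution keeps `{𝒫, V ≤ c₀}` and tends
to `0`. MODELLED: «synthetic lossless redispatched uniform-λ variant of the NE39 reduction» (not a
New England sentence). No solver. -/
theorem ne39lLff_well_subset_regionOfAttraction (lam : ℚ) (hlam : 0 < lam) {c₀ : ℝ}
    (hc₀ : ∀ k, c₀ < (cert lam hlam).V 0
      + (2 / (lam : ℝ) + (lam : ℝ) / 2) * NE39L.data.lffWo k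
        * vtGap (RecastData.lffδso NE39L.data.angleOf k))
    {y : Fin 9 ⊕ Fin 9 → ℝ}
    (hy : y ∈ (System.relativeSwing (Mμ NE39L.data) (Mref NE39L.data) (lam : ℝ)
      (RecastData.lffEo 9) NE39L.data.lffWo (RecastData.lffδso NE39L.data.angleOf)).polytope)
    (hyc : (cert lam hlam).V y ≤ c₀) :
    (∃ X : ℝ → Fin 9 ⊕ Fin 9 → ℝ, X 0 = y ∧
        ∀ T : ℝ, ∀ t ∈ Icc 0 T, HasDerivWithinAt X
          ((System.relativeSwing (Mμ NE39L.data) (Mref NE39L.data) (lam : ℝ) (RecastData.lffEo 9)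
            NE39L.data.lffWo (RecastData.lffδso NE39L.data.angleOf)).field (X t)) (Icc 0 T) t) ∧
      ∀ X : ℝ → Fin 9 ⊕ Fin 9 → ℝ, X 0 = y →
        (∀ T : ℝ, ∀ t ∈ Icc 0 T, HasDerivWithinAt X
          ((System.relativeSwing (Mμ NE39L.data) (Mref NE39L.data) (lam : ℝ) (RecastData.lffEo 9)
            NE39L.data.lffWo (RecastData.lffδso NE39L.data.angleOf)).field (X t)) (Icc 0 T) t) →
        (∀ t, 0 ≤ t → X t ∈ (System.relativeSwing (Mμ NE39L.data) (Mref NE39L.data) (lam : ℝ)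
            (RecastData.lffEo 9) NE39L.data.lffWo (RecastData.lffδso NE39L.data.angleOf)).polytope ∧
            (cert lam hlam).V (X t) ≤ c₀) ∧
          Tendsto X atTop (𝓝 0) :=
  well_subset_regionOfAttraction NE39L.data lam hlam _ M_pos nu_lt_Mμ cs_criterion NE39L.data_Cc_pos
    abs_δs_lt hc₀ hy hyc

/-- **P2 read on model-1's typed classical model (hypothesis-free: `NE39L` is lossless, reciprocal,
with exact A1 data).** For every `λ > 0`, every common acceleration `a′`, every level `c₀` as above
and EVERY solution `c` of `NE39L.data.toModelRel lam a′` on `univ` whose initial relative state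
`x(0) = ((δ_m − δ_0) − (θ*_m − θ*_0), ω_m − ω_0)_{m=1..9}` lies in the polytope with `V(x(0)) ≤ c₀`:
the relative state keeps `{𝒫, V ≤ c₀}` for all `t ≥ 0` and tends to `0` — all nine machines
synchronise with the reference machine `0` at the relative angles `θ*`. MODELLED as above; no
sentence here says a grid is stable. [cite: VuTuritsyn2016, §IV set ℛ; SauerPai1998, §6.10] -/
theorem synchronisation_of_isSolutionOn (lam : ℚ) (hlam : 0 < lam) (a : ℝ) {c₀ : ℝ}
    (hc₀ : ∀ k, c₀ < (cert lam hlam).V 0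
      + (2 / (lam : ℝ) + (lam : ℝ) / 2) * NE39L.data.lffWo k
        * vtGap (RecastData.lffδso NE39L.data.angleOf k))
    {c : ℝ → ClassicalSwing.State 10} (hc : (NE39L.data.toModelRel lam a).IsSolutionOn c univ)
    (hy : RecastData.lffState NE39L.data.angleOf (c 0) ∈
      (System.relativeSwing (Mμ NE39L.data) (Mref NE39L.data) (lam : ℝ) (RecastData.lffEo 9)
        NE39L.data.lffWo (RecastData.lffδso NE39L.data.angleOf)).polytope)
    (hyc : (cert lam hlam).V (RecastData.lffState NE39L.data.angleOf (c 0)) ≤ c₀) :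
    (∀ t, 0 ≤ t →
        RecastData.lffState NE39L.data.angleOf (c t) ∈
          (System.relativeSwing (Mμ NE39L.data) (Mref NE39L.data) (lam : ℝ) (RecastData.lffEo 9)
            NE39L.data.lffWo (RecastData.lffδso NE39L.data.angleOf)).polytope ∧
          (cert lam hlam).V (RecastData.lffState NE39L.data.angleOf (c t)) ≤ c₀) ∧
      Tendsto (fun t => RecastData.lffState NE39L.data.angleOf (c t)) atTop (𝓝 0) :=
  RelativeLff.synchronisation_of_isSolutionOn NE39L.data lam hlam a
    NE39L.data_transferConductance_eq_zero NE39L.data_B_symm NE39L.data_eqData _ M_pos nu_lt_Mμ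
    cs_criterion NE39L.data_Cc_pos abs_δs_lt hc₀ hc hy hyc

/-- The system certified here IS model-1's `NE39L.lffSystemOff lam` (definitional bookkeeping). -/
theorem lffSystemOff_eq (lam : ℚ) :
    NE39L.lffSystemOff lam = System.relativeSwing (Mμ NE39L.data) (Mref NE39L.data) (lam : ℝ)
      (RecastData.lffEo 9) NE39L.data.lffWo (RecastData.lffδso NE39L.data.angleOf) := rfl

end Summit.Ventures.GridStability.Lyapunov.NE39LLff

end
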